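import Mathlib

/-!
# Interval (based-Möbius) certificates: a rank criterion for lower bounds on set families

Helper file for crux `stmt-CriticalPhenomena-4575` (`NoHeavyLowerTail`, route `PercNearOneGluingNoHeavy`),
new-inequality factory seat `prim-ineq-gen-3` (gen 6).  Pure finite set theory / linear algebra; everything is PROVED.

**Setting.**  `K` is a finite family of finite sets and we want `card ι ≤ #K` for an index type `ι` (in the
applications: the members of three cross-intersecting families, `K` = their differences / meets / witnessed
differences, memo `COMB.md` §3c (xviii)–(xix)).  Gen 5's `OrderedDifferences.card_le_card_of_rank` proves this
from 'avatars' `A i` with `A i ⊄ A j` and `A i \ A j ∈ K` along a rank function — the Möbius-weighted rank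
argument with all weights based at `∅`.  That certificate provably cannot exist for the three-family inequality
`MS3-cyc` (parity obstruction, memo §3c (xviii)).  The present file proves the general **interval certificate**:

**Theorem (`card_le_card_of_certificate`).**  Suppose each index `i` carries three finite sets with
`L i = U i ∩ V i ∈ K`, and along a rank function `r` (ties allowed), whenever `i ≠ j` and `r i ≤ r j`, either
`L i ⊄ V j`, or `U i ∩ V j` is a member of `K` different from `L i`.  Then `card ι ≤ #K`.

*Proof.*  Let `μ_i` be the Möbius weights of `(K, ⊆)` based at `L i` (`exists_moebius_weights_from`:
`∑_{E ∈ K, L ⊆ E ⊆ Z} μ E = [Z = L]` for `Z ∈ K`).  With `P i E = μ_i E · [L i ⊆ E ⊆ U i]` and `Q E j = [E ⊆ V j]`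
one gets `(P Q) i j = ∑_{E ∈ K, L i ⊆ E ⊆ U i ∩ V j} μ_i E`, which is `0` if `L i ⊄ V j`, and `[U i ∩ V j = L i]` if
`U i ∩ V j ∈ K`; so `P Q` is block unitriangular along `r`, `rank P = card ι`, and `card ι ≤ #K`.
Gen 5's theorem is the case `L i = ∅`, `U i = A i`, `V j = S \ A j`.  The new freedom (bases `L i ≠ ∅`: 'trace'
functionals `(X ∩ Z, Z)` with value `[X' ∩ Z = X ∩ Z]`, and 'private elements' `(L, L)` with value `[L ⊆ X']`)
is what the three-family inequality needs: such certificates exist for every instance of `MS3-cyc` on ground sets of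
size `≤ 5` with at most six members and in all random tests up to size 7 (memo §3c (xix)(5), conjecture `CERT`).
(prim-ineq-gen-3 gen 6, 2026-08-20; memo `run/shared/lean/prim/prim-ineq-gen-3/COMB.md` §3c (xix).)
-/

namespace Summit.CriticalPhenomena.PercolationContinuityZ3.Theorems

namespace IntervalCertificate

open Finset Matrix

variable {α : Type*} [DecidableEq α]

/-- **Based Möbius weights.**  For a finite family `T` of finite sets and a base set `L` there are rational
weights `μ` with `∑_{E ∈ T, L ⊆ E ⊆ Z} μ E = [Z = L]` for every `Z ∈ T` (the Möbius function of the poset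
`(T ∪ {L}, ⊆)` relative to `L`; built by strong recursion `μ s = [s = L] - ∑_{t ∈ T, L ⊆ t ⊂ s} μ t`). -/
theorem exists_moebius_weights_from (T : Finset (Finset α)) (L : Finset α) :
    ∃ μ : Finset α → ℚ, ∀ Z ∈ T,
      ∑ E ∈ T.filter (fun E => L ⊆ E ∧ E ⊆ Z), μ E = if Z = L then 1 else 0 := by
  let H : (s : Finset α) → ((t : Finset α) → t ⊂ s → ℚ) → ℚ := fun s ih =>
    (if s = L then (1 : ℚ) else 0) -
      ∑ t ∈ (T.filter (fun t => L ⊆ t ∧ t ⊂ s)).attach, ih t.1 (mem_filter.mp t.2).2.2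
  let μ : Finset α → ℚ := Finset.strongInduction H
  have hμ : ∀ s, μ s = (if s = L then (1 : ℚ) else 0) - ∑ t ∈ T.filter (fun t => L ⊆ t ∧ t ⊂ s), μ t := by
    intro s
    have e : μ s = H s (fun t _ => μ t) := Finset.strongInduction_eq H s
    rw [e]
    show (if s = L then (1 : ℚ) else 0) -
      ∑ t ∈ (T.filter (fun t => L ⊆ t ∧ t ⊂ s)).attach, μ t.1 = _
    rw [sum_attach (T.filter (fun t => L ⊆ t ∧ t ⊂ s)) (fun t => μ t)]
  refine ⟨μ, fun Z hZ => ?_⟩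
  by_cases hLZ : L ⊆ Z
  · have hsplit : T.filter (fun E => L ⊆ E ∧ E ⊆ Z) =
        insert Z (T.filter (fun E => L ⊆ E ∧ E ⊂ Z)) := by
      ext E
      simp only [mem_filter, mem_insert]
      constructor
      · rintro ⟨hE, hLE, hEZ⟩
        rcases lt_or_eq_of_le hEZ with h | h
        · exact Or.inr ⟨hE, hLE, h⟩
        · exact Or.inl h
      · rintro (rfl | ⟨hE, hLE, hEZ⟩)
        · exact ⟨hZ, hLZ, subset_rfl⟩
        · exact ⟨hE, hLE, hEZ.le⟩
    have hnot : Z ∉ T.filter (fun E => L ⊆ E ∧ E ⊂ Z) := by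
      intro h
      exact lt_irrefl Z (mem_filter.mp h).2.2
    rw [hsplit, sum_insert hnot, hμ]
    abel
  · -- no `E` with `L ⊆ E ⊆ Z`, and `Z ≠ L`
    have hempty : T.filter (fun E => L ⊆ E ∧ E ⊆ Z) = ∅ := by
      apply filter_eq_empty_iff.mpr
      rintro E - ⟨hLE, hEZ⟩
      exact hLZ (hLE.trans hEZ)
    have hne : Z ≠ L := by
      rintro rfl
      exact hLZ subset_rfl
    rw [hempty, sum_empty, if_neg hne]

/-- **Interval certificates.**  Let `K` be a finite family of finite sets and, for each index `i`, let
`L i = U i ∩ V i` be a member of `K`.  If along a rank function `r` into a linear order, for all `i ≠ j`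
with `r i ≤ r j`, either `L i ⊄ V j` or `U i ∩ V j` is a member of `K` different from `L i`, then
`card ι ≤ #K`.  (The columns are the incidence vectors `E ↦ [E ⊆ V j]` of the sets `V j` on `K`; the rows
are Möbius functionals based at `L i` on the interval `[L i, U i]`; their pairing matrix is block
unitriangular.) -/
theorem card_le_card_of_certificate {ι β : Type*} [Fintype ι] [DecidableEq ι] [LinearOrder β]
    (K : Finset (Finset α)) (r : ι → β) (L U V : ι → Finset α)
    (hL : ∀ i, L i = U i ∩ V i) (hLK : ∀ i, L i ∈ K)
    (hsep : ∀ ⦃i j : ι⦄, i ≠ j → r i ≤ r j →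
      ¬ L i ⊆ V j ∨ (U i ∩ V j ∈ K ∧ U i ∩ V j ≠ L i)) :
    Fintype.card ι ≤ #K := by
  classical
  -- based Möbius weights for every index
  have hw : ∀ i : ι, ∃ μ : Finset α → ℚ, ∀ Z ∈ K,
      ∑ E ∈ K.filter (fun E => L i ⊆ E ∧ E ⊆ Z), μ E = if Z = L i then 1 else 0 :=
    fun i => exists_moebius_weights_from K (L i)
  choose μ hμ using hw
  have hLU : ∀ i, L i ⊆ U i := fun i => by rw [hL i]; exact inter_subset_left
  -- the pairing sums
  have key0 : ∀ i j : ι, ¬ L i ⊆ V j →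
      ∑ E ∈ K.filter (fun E => L i ⊆ E ∧ E ⊆ U i ∩ V j), μ i E = 0 := by
    intro i j h
    have hempty : K.filter (fun E => L i ⊆ E ∧ E ⊆ U i ∩ V j) = ∅ := by
      apply filter_eq_empty_iff.mpr
      rintro E - ⟨hLE, hEUV⟩
      exact h (hLE.trans ((subset_inter_iff.mp hEUV).2))
    rw [hempty, sum_empty]
  have key1 : ∀ i j : ι, U i ∩ V j ∈ K →
      ∑ E ∈ K.filter (fun E => L i ⊆ E ∧ E ⊆ U i ∩ V j), μ i E =
        if U i ∩ V j = L i then 1 else 0 := by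
    intro i j h
    exact hμ i _ h
  -- the two matrices
  let P : Matrix ι K ℚ := fun i E => if L i ⊆ (E : Finset α) ∧ (E : Finset α) ⊆ U i then μ i E else 0
  let Q : Matrix K ι ℚ := fun E j => if (E : Finset α) ⊆ V j then 1 else 0
  have hPQ : ∀ i j, (P * Q) i j = ∑ E ∈ K.filter (fun E => L i ⊆ E ∧ E ⊆ U i ∩ V j), μ i E := by
    intro i j
    rw [Matrix.mul_apply]
    have h1 : ∑ E : K, P i E * Q E j =
        ∑ E ∈ K, (if L i ⊆ E ∧ E ⊆ U i then μ i E else 0) * (if E ⊆ V j then 1 else 0) :=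
      Finset.sum_coe_sort K (fun E => (if L i ⊆ E ∧ E ⊆ U i then μ i E else 0) *
        (if E ⊆ V j then 1 else 0))
    rw [h1, sum_filter]
    refine sum_congr rfl fun E _ => ?_
    by_cases ha : L i ⊆ E ∧ E ⊆ U i <;> by_cases hb : E ⊆ V j <;>
      simp [ha, hb, subset_inter_iff]
  -- diagonal entries are `1`
  have hone : ∀ i : ι, (P * Q) i i = 1 := by
    intro i
    have hK : U i ∩ V i ∈ K := by rw [← hL i]; exact hLK i
    rw [hPQ, key1 i i hK, if_pos (hL i).symm]
  -- entries above the diagonal (along `r`) vanish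
  have hzero : ∀ i j : ι, i ≠ j → r i ≤ r j → (P * Q) i j = 0 := by
    intro i j hij hr
    rw [hPQ]
    rcases hsep hij hr with h | ⟨hK, hne⟩
    · exact key0 i j h
    · rw [key1 i j hK, if_neg hne]
  have hBT : (P * Q).BlockTriangular (OrderDual.toDual ∘ r) := by
    intro i j hij
    have hij' : r i < r j := hij
    exact hzero i j (fun h => by subst h; exact lt_irrefl _ hij') hij'.le
  have hdet : (P * Q).det = 1 := by
    rw [hBT.det]
    refine prod_eq_one fun a _ => ?_
    have hblock : (P * Q).toSquareBlock (OrderDual.toDual ∘ r) a = 1 := by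
      ext ⟨i, hi⟩ ⟨j, hj⟩
      rw [toSquareBlock_def, of_apply]
      by_cases h : i = j
      · subst h
        rw [hone, one_apply_eq]
      · have hr : r i = r j := by
          have h1 : OrderDual.toDual (r i) = a := hi
          have h2 : OrderDual.toDual (r j) = a := hj
          exact OrderDual.toDual.injective (h1.trans h2.symm)
        rw [hzero i j h hr.le, one_apply_ne (fun h' => h (Subtype.ext_iff.mp h'))]
    rw [hblock, det_one]
  have hunit : IsUnit (P * Q) := by
    rw [Matrix.isUnit_iff_isUnit_det, hdet]
    exact isUnit_one
  calc Fintype.card ι = (P * Q).rank := (rank_of_isUnit _ hunit).symm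
    _ ≤ P.rank := rank_mul_le_left P Q
    _ ≤ Fintype.card K := rank_le_card_width P
    _ = #K := Fintype.card_coe K

/-- The avatar form of gen 5 (`OrderedDifferences.card_le_card_of_rank`) is the special case of
`card_le_card_of_certificate` with all bases `L i = ∅`, `U i = A i` and `V j = S \ A j` inside a common
superset `S`: avatars `A i ⊆ S` with `A i ⊄ A j` and `A i \ A j ∈ K` along the rank. -/
theorem card_le_card_of_avatars {ι β : Type*} [Fintype ι] [DecidableEq ι] [LinearOrder β]
    (K : Finset (Finset α)) (S : Finset α) (r : ι → β) (A : ι → Finset α) (hAS : ∀ i, A i ⊆ S)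
    (h0 : ∅ ∈ K) (hA : ∀ ⦃i j : ι⦄, i ≠ j → r i ≤ r j → ¬ A i ⊆ A j)
    (hT : ∀ ⦃i j : ι⦄, i ≠ j → r i ≤ r j → A i \ A j ∈ K) :
    Fintype.card ι ≤ #K := by
  refine card_le_card_of_certificate K r (fun _ => ∅) A (fun j => S \ A j) ?_ (fun _ => h0) ?_
  · intro i
    ext x
    simp only [notMem_empty, mem_inter, mem_sdiff, false_iff, not_and, not_not]
    exact fun h _ => h
  · intro i j hij hr
    refine Or.inr ⟨?_, ?_⟩
    · have e : A i ∩ (S \ A j) = A i \ A j := by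
        ext x
        simp only [mem_inter, mem_sdiff]
        constructor
        · rintro ⟨h1, -, h3⟩; exact ⟨h1, h3⟩
        · rintro ⟨h1, h3⟩; exact ⟨h1, hAS i h1, h3⟩
      rw [e]; exact hT hij hr
    · intro h
      apply hA hij hr
      intro x hx
      by_contra hxj
      have : x ∈ A i ∩ (S \ A j) := mem_inter.mpr ⟨hx, mem_sdiff.mpr ⟨hAS i hx, hxj⟩⟩
      rw [h] at this
      exact notMem_empty x this

/-- **Coplain elimination with plain separators** (the form used for three cross-intersecting families, memo
§3c (xix)(5)).  Let `Zs` ('coplain' members) and `Xs` ('plain' members) be disjoint families of subsets of `S`, and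
let `K ∋ ∅` contain all differences `Z \ Z'` (`Z, Z' ∈ Zs`) and all meets `Z ∩ X` (`Z ∈ Zs`, `X ∈ Xs`), the latter
being nonempty.  Suppose the plain members carry separators along a rank function `ρ`: sets `Lp X = Up X ∩ X ∈ K`
such that for `X ≠ X'` in `Xs` with `ρ X ≤ ρ X'`, either `Lp X ⊄ X'` or `Up X ∩ X'` is a member of `K` other than
`Lp X` (e.g. a *trace* separator `Up X = Z ∈ Zs`, `Lp X = X ∩ Z`, valid when `X' ∩ Z ≠ X ∩ Z` for all later `X'`;
or a *private element* `Up X = Lp X ⊆ X` contained in no later `X'`).  Then `#Zs + #Xs ≤ #K`: the coplain members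
need no data at all — their Möbius functionals vanish on every plain column because `Z ∩ X ∈ K \ {∅}`. -/
theorem card_add_card_le_card_of_separators (S : Finset α) (K Zs Xs : Finset (Finset α))
    (hZP : Disjoint Zs Xs) (hZS : ∀ Z ∈ Zs, Z ⊆ S) (h0 : ∅ ∈ K)
    (hZZ : ∀ Z ∈ Zs, ∀ Z' ∈ Zs, Z \ Z' ∈ K)
    (hZX : ∀ Z ∈ Zs, ∀ X ∈ Xs, Z ∩ X ∈ K ∧ (Z ∩ X).Nonempty)
    (ρ : Finset α → ℕ) (Lp Up : Finset α → Finset α)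
    (hLp : ∀ X ∈ Xs, Lp X = Up X ∩ X ∧ Lp X ∈ K)
    (hsep : ∀ X ∈ Xs, ∀ X' ∈ Xs, X ≠ X' → ρ X ≤ ρ X' →
      ¬ Lp X ⊆ X' ∨ (Up X ∩ X' ∈ K ∧ Up X ∩ X' ≠ Lp X)) :
    #Zs + #Xs ≤ #K := by
  classical
  -- index type: the members of `Zs ∪ Xs`; coplain members ranked below all plain members, larger first
  let r : ↥(Zs ∪ Xs) → ℤ := fun i =>
    if (i : Finset α) ∈ Zs then -((#(i : Finset α) : ℤ)) - 1 else (ρ i : ℤ)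
  let L : ↥(Zs ∪ Xs) → Finset α := fun i => if (i : Finset α) ∈ Zs then ∅ else Lp i
  let U : ↥(Zs ∪ Xs) → Finset α := fun i => if (i : Finset α) ∈ Zs then (i : Finset α) else Up i
  let V : ↥(Zs ∪ Xs) → Finset α := fun i => if (i : Finset α) ∈ Zs then S \ (i : Finset α) else (i : Finset α)
  have hPnot : ∀ X ∈ Xs, X ∉ Zs := fun X hX hXZ => Finset.disjoint_left.mp hZP hXZ hX
  have hmain := card_le_card_of_certificate (ι := ↥(Zs ∪ Xs)) K r L U V ?_ ?_ ?_
  · rwa [Fintype.card_coe, card_union_of_disjoint hZP] at hmain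
  · -- `L = U ∩ V`
    rintro ⟨i, hi⟩
    by_cases hiZ : i ∈ Zs
    · simp only [L, U, V, hiZ, if_true]
      ext x
      simp
    · have hiP : i ∈ Xs := (mem_union.mp hi).resolve_left hiZ
      simp only [L, U, V, hiZ, if_false]
      exact (hLp i hiP).1
  · -- `L ∈ K`
    rintro ⟨i, hi⟩
    by_cases hiZ : i ∈ Zs
    · simp only [L, hiZ, if_true]; exact h0
    · have hiP : i ∈ Xs := (mem_union.mp hi).resolve_left hiZ
      simp only [L, hiZ, if_false]; exact (hLp i hiP).2
  · -- separation along `r`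
    rintro ⟨i, hi⟩ ⟨j, hj⟩ hne hr
    simp only [ne_eq, Subtype.mk.injEq] at hne
    by_cases hiZ : i ∈ Zs <;> by_cases hjZ : j ∈ Zs
    · -- coplain / coplain: `U ∩ V = i \ j`, nonempty since `#i ≥ #j`, `i ≠ j`
      simp only [L, U, V, r, hiZ, hjZ, if_true] at hr ⊢
      have hle : #j ≤ #i := by omega
      refine Or.inr ⟨?_, ?_⟩
      · have e : i ∩ (S \ j) = i \ j := by
          ext x; simp only [mem_inter, mem_sdiff]
          exact ⟨fun ⟨h1, _, h3⟩ => ⟨h1, h3⟩, fun ⟨h1, h3⟩ => ⟨h1, hZS i hiZ h1, h3⟩⟩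
        rw [e]; exact hZZ i hiZ j hjZ
      · intro h
        have hsub : i ⊆ j := by
          intro x hx; by_contra hxj
          have : x ∈ i ∩ (S \ j) := mem_inter.mpr ⟨hx, mem_sdiff.mpr ⟨hZS i hiZ hx, hxj⟩⟩
          rw [h] at this; exact notMem_empty x this
        exact hne (eq_of_subset_of_card_le hsub hle)
    · -- coplain / plain: `U ∩ V = i ∩ j ∈ K \ {∅}`
      have hjP : j ∈ Xs := (mem_union.mp hj).resolve_left hjZ
      simp only [L, U, V, hiZ, hjZ, if_true, if_false]
      refine Or.inr ⟨(hZX i hiZ j hjP).1, ?_⟩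
      exact (hZX i hiZ j hjP).2.ne_empty
    · -- plain / coplain: impossible along `r`
      exfalso
      simp only [r, hiZ, hjZ, if_true, if_false] at hr
      omega
    · -- plain / plain: the given separators
      have hiP : i ∈ Xs := (mem_union.mp hi).resolve_left hiZ
      have hjP : j ∈ Xs := (mem_union.mp hj).resolve_left hjZ
      simp only [L, U, V, r, hiZ, hjZ, if_false] at hr ⊢
      exact hsep i hiP j hjP hne (by exact_mod_cast hr)

end IntervalCertificate

end Summit.CriticalPhenomena.PercolationContinuityZ3.Theorems
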